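import Summits.HodgeConjecture.HodgeConjecture.Theorems.K2LiuRankOneHeckeCellsTwo

/-!
# The hyperspecial Hecke neighbours of the unramified `U(1,1)`: a CONTRACTING transversal of `K₀ t K₀ ∕ K₀`, `t = diag(ϖ, ϖ⁻¹)`,
# of type `(|X₊|, |X₀|) = (q, √q − 1)` (LOCAL SEAM of s23, inert package, organ (26-n) H2, part B)

Track B ∕ K2-LIT, hLiu418 = stmt-HodgeConjecture-24832; inert package of the local seam of s23 (words
`K2/K2Liu-p01/g3/INERT-SOCKETS-v2.K2Liup01g3.md`, plan `PLAN-28i-row26.K2Liup01g3.md`). Helper (count-neutral, own head per LEAD R3):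
the `N = 2` TWIN of ★ (L1) `bijOn_heckeNeighbours` and ★ (L1b) `HyperspecialUnitaryRankOneNotSquareIntegrable` §1 §2 §5, over the abstract datum
★ `UnramifiedLocalConjDatum σ ϖ` (`q := #𝓀[K]`, `√q := Nat.sqrt q` — for `K = E_w` at an inert place, `q = q_v²`, `√q = q_v`), on the cells of part A
★ `K2LiuRankOneHeckeCellsTwo`:
* §8 **`bijOn_heckeNeighbours_two`**: `X = R₊·t ∪ R₀ ∪ {t⁻¹}` is a transversal of `K₀tK₀∕K₀` for every transversal `R₊` of `K_P ∕ tK_Pt⁻¹` and every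
  set `R₀` of unitriangular `u(β)`, `v β = v(ϖ⁻¹)`, transversal for `v(β′ − β) ≤ 1`;
* §9 the COUNTS `|R₊| = [K_P : tK_Pt⁻¹] = q` (★ `relIndex_conjAct_borelInt_eq_pow_two`), `|R₀| = √q − 1` (★ `exists_transversal_traceZero` + the
  section ★ `exists_unitriangular_apply_eq_two`), and the PACKAGE **`exists_contractingTransversal_unitary_two`** = the binder list of ★
  `K2LiuHeckeShellRecursion.heckeOperator_pow_apply_eq_smul_of_contracting` (p857139): hence `[K₀tᵐK₀] v = μ_m v` with, for `√q = q_v`,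
  `μ₂ = (a₁ − q_v + 1)a₁ − q_v(q_v+1)`, `μ_{n+3} = (a₁ − q_v + 1)μ_{n+2} − q_v²μ_{n+1}` — the recursion of ★ `K2LiuCartanSeriesU11Closed` (#28i).
[BruhatTits1972, (4.4.4)]; [Tits1979, §3.3.3]; [SerreTrees1980, II.1.1]; [Macdonald1971, Ch. V §3]; [Rogawski1990, §1.10].
Theorems only; no `sorry`; no definition (`t` is a binder, `u(β)` is chosen inside proofs). HONEST LABEL: HC_CM is proved only modulo the printed
citations (2 remaining named inputs: hLiu418 = stmt-HodgeConjecture-24832, h413 = stmt-HodgeConjecture-24833) until rung 0 closes; this file is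
unconditional and moves no counter.
-/

set_option autoImplicit false

set_option linter.dupNamespace false

noncomputable section

open scoped Valued WithZero Matrix MatrixGroups Pointwise
open MulAction ConjAct

namespace Summit.HodgeConjecture.HodgeConjecture.Cruxes.HLiu418.K2LiuRankOneHeckeNeighboursTwo

open Literature.NumberTheory.Automorphic Literature.NumberTheory.Automorphic.HermitianLattice
open Literature.NumberTheory.Automorphic.CartanUnique Literature.NumberTheory.Automorphic.SymplecticCartan
open Literature.NumberTheory.Automorphic.HermitianLattice.UnramifiedLocalConjDatum
open Summit.HodgeConjecture.HodgeConjecture.Cruxes.HLiu418.K2LiuRankOneHeckeCellsTwo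

variable {K : Type*} [Field K] [Valued K ℤᵐ⁰] {σ : K →+* K} {ϖ : K}

/-! ## §8 THE CONTRACTING TRANSVERSAL of `K₀ t K₀ ∕ K₀` -/

/-- **THE HYPERSPECIAL HECKE NEIGHBOURS OF `U(1,1)`** — for any transversal `R₊ ⊆ K_P` of `K_P ∕ t K_P t⁻¹` and any finite set `R₀` of unitriangular
`u(β)`, `v β = v(ϖ⁻¹)`, which is a transversal for the relation `v(β′ − β) ≤ 1` among such elements, the finite set `X = R₊·t ∪ R₀ ∪ {t⁻¹}` maps
BIJECTIVELY onto `K₀ t K₀ ∕ K₀`. [cite: BruhatTits1972, (4.4.4)] [cite: Tits1979, §3.3.3] [cite: SerreTrees1980, II.1.1] -/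
theorem bijOn_heckeNeighbours_two [DecidableEq (unitaryGroupOfForm σ ((StdForm.antidiagonal 2).over K))] (hd : UnramifiedLocalConjDatum σ ϖ)
    {t : unitaryGroupOfForm σ ((StdForm.antidiagonal 2).over K)}
    (ht : (t : GL (Fin 2) K) = zpowDiagGL (uniformizer_ne_zero hd.vϖ) ![(1 : ℤ), -1])
    {Rp : Finset (unitaryGroupOfForm σ ((StdForm.antidiagonal 2).over K))}
    (hRp : ∀ u ∈ Rp, u ∈ hd.borelLatticeU ⊓ unitaryInt σ ((StdForm.antidiagonal 2).over K))
    (hRp_inj : ∀ u ∈ Rp, ∀ u' ∈ Rp, u⁻¹ * u' ∈ toConjAct t • (hd.borelLatticeU ⊓ unitaryInt σ ((StdForm.antidiagonal 2).over K)) → u = u')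
    (hRp_surj : ∀ u ∈ hd.borelLatticeU ⊓ unitaryInt σ ((StdForm.antidiagonal 2).over K),
      ∃ r ∈ Rp, r⁻¹ * u ∈ toConjAct t • (hd.borelLatticeU ⊓ unitaryInt σ ((StdForm.antidiagonal 2).over K)))
    {R0 : Finset (unitaryGroupOfForm σ ((StdForm.antidiagonal 2).over K))}
    (hR0 : ∀ u ∈ R0, (u : GL (Fin 2) K) ∈ upperUnitriangular (Fin 2) K ∧
      Valued.v (((u : GL (Fin 2) K) : Matrix (Fin 2) (Fin 2) K) 0 1) = WithZero.exp (1 : ℤ))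
    (hR0_inj : ∀ u ∈ R0, ∀ u' ∈ R0,
      Valued.v (((u' : GL (Fin 2) K) : Matrix (Fin 2) (Fin 2) K) 0 1 - ((u : GL (Fin 2) K) : Matrix (Fin 2) (Fin 2) K) 0 1) ≤ 1 → u = u')
    (hR0_surj : ∀ u : unitaryGroupOfForm σ ((StdForm.antidiagonal 2).over K), (u : GL (Fin 2) K) ∈ upperUnitriangular (Fin 2) K →
      Valued.v (((u : GL (Fin 2) K) : Matrix (Fin 2) (Fin 2) K) 0 1) = WithZero.exp (1 : ℤ) →
      ∃ r ∈ R0, Valued.v (((u : GL (Fin 2) K) : Matrix (Fin 2) (Fin 2) K) 0 1 - ((r : GL (Fin 2) K) : Matrix (Fin 2) (Fin 2) K) 0 1) ≤ 1) :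
    Set.BijOn (fun x : unitaryGroupOfForm σ ((StdForm.antidiagonal 2).over K) =>
        (x : unitaryGroupOfForm σ ((StdForm.antidiagonal 2).over K) ⧸ unitaryInt σ ((StdForm.antidiagonal 2).over K)))
      (Rp.image (· * t) ∪ R0 ∪ {t⁻¹} : Finset _)
      (orbit (unitaryInt σ ((StdForm.antidiagonal 2).over K))
        (t : unitaryGroupOfForm σ ((StdForm.antidiagonal 2).over K) ⧸ unitaryInt σ ((StdForm.antidiagonal 2).over K))) := by
  -- orbit membership = shell membership
  have horb : ∀ g : unitaryGroupOfForm σ ((StdForm.antidiagonal 2).over K),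
      (g : unitaryGroupOfForm σ ((StdForm.antidiagonal 2).over K) ⧸ unitaryInt σ ((StdForm.antidiagonal 2).over K)) ∈
        orbit (unitaryInt σ ((StdForm.antidiagonal 2).over K))
          (t : unitaryGroupOfForm σ ((StdForm.antidiagonal 2).over K) ⧸ unitaryInt σ ((StdForm.antidiagonal 2).over K)) ↔
      g ∈ DoubleCoset.doubleCoset t (unitaryInt σ ((StdForm.antidiagonal 2).over K) : Set _) (unitaryInt σ ((StdForm.antidiagonal 2).over K)) := by
    intro g
    rw [heckeAlgebra.coe_mem_orbit_coe_iff, DoubleCoset.mem_doubleCoset]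
    simp only [SetLike.mem_coe]
  -- membership in the three pieces
  have hmem : ∀ x, x ∈ (Rp.image (· * t) ∪ R0 ∪ {t⁻¹} : Finset _) ↔ (∃ u ∈ Rp, u * t = x) ∨ x ∈ R0 ∨ x = t⁻¹ := by
    intro x
    simp only [Finset.mem_union, Finset.mem_image, Finset.mem_singleton, or_assoc]
  refine ⟨fun x hx => ?_, fun x hx x' hx' hxx' => ?_, fun q hq => ?_⟩
  · -- MapsTo
    rw [horb]
    rcases (hmem x).1 hx with ⟨u, hu, rfl⟩ | hx0 | rfl
    · exact DoubleCoset.mem_doubleCoset.2 ⟨u, (Subgroup.mem_inf.1 (hRp u hu)).2, 1, Subgroup.one_mem _, (mul_one _).symm⟩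
    · exact unip_mem_doubleCoset_two hd ht (hR0 x hx0).1 (hR0 x hx0).2
    · exact inv_mem_doubleCoset_two hd t
  · -- InjOn: equal cosets have equal Iwasawa exponents, hence the same cell; inside a cell the transversal hypotheses decide
    have hexp := hd.iwasawaExp_eq_of_coe_eq hxx'
    rcases (hmem x).1 hx with ⟨u, hu, rfl⟩ | hx0 | rfl <;>
      rcases (hmem x').1 hx' with ⟨u', hu', rfl⟩ | hx0' | rfl
    · rw [hRp_inj u hu u' hu' ((mul_coe_eq_iff_two hd ht (hRp u hu) (hRp u' hu')).1 hxx')]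
    · rw [iwasawaExp_mul_two hd ht (hRp u hu), iwasawaExp_unip_two hd (hR0 x' hx0').1] at hexp
      exact absurd (congrFun hexp 0) (by simp)
    · rw [iwasawaExp_mul_two hd ht (hRp u hu), iwasawaExp_inv_two hd ht] at hexp
      exact absurd (congrFun hexp 0) (by simp)
    · rw [iwasawaExp_mul_two hd ht (hRp u' hu'), iwasawaExp_unip_two hd (hR0 x hx0).1] at hexp
      exact absurd (congrFun hexp 0) (by simp)
    · exact hR0_inj x hx0 x' hx0' ((unip_coe_eq_iff hd (hR0 x hx0).1 (hR0 x' hx0').1).1 hxx')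
    · rw [iwasawaExp_unip_two hd (hR0 x hx0).1, iwasawaExp_inv_two hd ht] at hexp
      exact absurd (congrFun hexp 0) (by simp)
    · rw [iwasawaExp_mul_two hd ht (hRp u' hu'), iwasawaExp_inv_two hd ht] at hexp
      exact absurd (congrFun hexp 0) (by simp)
    · rw [iwasawaExp_unip_two hd (hR0 x' hx0').1, iwasawaExp_inv_two hd ht] at hexp
      exact absurd (congrFun hexp 0) (by simp)
    · rfl
  · -- SurjOn: exhaustion, then the transversal hypotheses
    obtain ⟨g, rfl⟩ := QuotientGroup.mk_surjective q
    have hg := (horb g).1 hq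
    rcases exists_rep_of_mem_doubleCoset_two hd ht hg with ⟨u, hu, hgu⟩ | ⟨u, hu, hβ, hgu⟩ | hgt
    · obtain ⟨r, hr, hru⟩ := hRp_surj u hu
      exact ⟨r * t, Finset.mem_coe.2 ((hmem _).2 (Or.inl ⟨r, hr, rfl⟩)),
        (((mul_coe_eq_iff_two hd ht (hRp r hr) hu).2 hru).trans hgu.symm)⟩
    · obtain ⟨r, hr, hru⟩ := hR0_surj u hu hβ
      exact ⟨r, Finset.mem_coe.2 ((hmem _).2 (Or.inr (Or.inl hr))),
        (((unip_coe_eq_iff hd (hR0 r hr).1 hu).2 hru).trans hgu.symm)⟩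
    · exact ⟨t⁻¹, Finset.mem_coe.2 ((hmem _).2 (Or.inr (Or.inr rfl))), hgt.symm⟩

/-! ## §9 The counts and the package -/

/-- **A transversal `R₊ ⊆ K_P` of `K_P ∕ t K_P t⁻¹` with `#R₊ = q`** (`q = #𝓀[K]`; ★ `relIndex_conjAct_borelInt_eq_pow_two` at `(1,−1)` and Mathlib's
`Subgroup.exists_isComplement_left`). [cite: BruhatTits1972, (4.4.4)] [cite: CartierCorvallis1979, §IV (4.2)] -/
theorem exists_transversal_borelInt_two (hd : UnramifiedLocalConjDatum σ ϖ) (hσ : ∃ x : K, σ x ≠ x) [Finite 𝓀[K]]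
    {t : unitaryGroupOfForm σ ((StdForm.antidiagonal 2).over K)}
    (ht : (t : GL (Fin 2) K) = zpowDiagGL (uniformizer_ne_zero hd.vϖ) ![(1 : ℤ), -1]) :
    ∃ Rp : Finset (unitaryGroupOfForm σ ((StdForm.antidiagonal 2).over K)),
      (∀ u ∈ Rp, u ∈ hd.borelLatticeU ⊓ unitaryInt σ ((StdForm.antidiagonal 2).over K)) ∧
      (∀ u ∈ Rp, ∀ u' ∈ Rp, u⁻¹ * u' ∈ toConjAct t • (hd.borelLatticeU ⊓ unitaryInt σ ((StdForm.antidiagonal 2).over K)) → u = u') ∧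
      (∀ u ∈ hd.borelLatticeU ⊓ unitaryInt σ ((StdForm.antidiagonal 2).over K),
        ∃ r ∈ Rp, r⁻¹ * u ∈ toConjAct t • (hd.borelLatticeU ⊓ unitaryInt σ ((StdForm.antidiagonal 2).over K))) ∧
      Rp.card = Nat.card 𝓀[K] := by
  classical
  set KP := hd.borelLatticeU ⊓ unitaryInt σ ((StdForm.antidiagonal 2).over K) with hKP
  set A := toConjAct t • KP with hA
  set H' : Subgroup KP := A.subgroupOf KP with hH'
  obtain ⟨S, hS, -⟩ := H'.exists_isComplement_left 1
  have hidx : H'.index = Nat.card 𝓀[K] := by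
    change A.relIndex KP = _
    have h := hd.relIndex_conjAct_borelInt_eq_pow_two hσ rev_vecOne
    rw [← eq_mk_of_coe_eq hd ht, show ((![(1 : ℤ), -1] : Fin 2 → ℤ) 0).toNat = 1 by rfl, pow_one] at h
    exact h
  have hcardS : Nat.card S = Nat.card 𝓀[K] := hS.card_left.trans hidx
  haveI : Nonempty 𝓀[K] := ⟨0⟩
  have hq0 : Nat.card 𝓀[K] ≠ 0 := Nat.card_pos.ne'
  have hSfin : S.Finite := Nat.finite_of_card_ne_zero (by rw [hcardS]; exact hq0)
  have huniq := Subgroup.isComplement_iff_existsUnique_inv_mul_mem.1 hS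
  refine ⟨hSfin.toFinset.image (fun s : KP => (s : unitaryGroupOfForm σ ((StdForm.antidiagonal 2).over K))), ?_, ?_, ?_, ?_⟩
  · intro u hu
    obtain ⟨s, -, rfl⟩ := Finset.mem_image.1 hu
    exact s.2
  · intro u hu u' hu' huu'
    obtain ⟨s, hs, rfl⟩ := Finset.mem_image.1 hu
    obtain ⟨s', hs', rfl⟩ := Finset.mem_image.1 hu'
    rw [Set.Finite.mem_toFinset] at hs hs'
    obtain ⟨x, -, hx⟩ := huniq s'
    have h1 : (⟨s, hs⟩ : S) = x := hx ⟨s, hs⟩ (by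
      change (s : KP)⁻¹ * s' ∈ H'
      rw [Subgroup.mem_subgroupOf]; simpa using huu')
    have h2 : (⟨s', hs'⟩ : S) = x := hx ⟨s', hs'⟩ (by
      change (s' : KP)⁻¹ * s' ∈ H'
      rw [inv_mul_cancel]; exact H'.one_mem)
    have h3 := h1.trans h2.symm
    rw [Subtype.mk.injEq] at h3
    rw [h3]
  · intro u hu
    obtain ⟨x, hx, -⟩ := huniq ⟨u, hu⟩
    refine ⟨((x : KP) : unitaryGroupOfForm σ ((StdForm.antidiagonal 2).over K)),
      Finset.mem_image.2 ⟨(x : KP), by rw [Set.Finite.mem_toFinset]; exact x.2, rfl⟩, ?_⟩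
    rw [SetLike.mem_coe, Subgroup.mem_subgroupOf] at hx
    simpa using hx
  · rw [Finset.card_image_of_injective _ Subtype.val_injective, ← Set.ncard_eq_toFinset_card S hSfin, ← Nat.card_coe_set_eq, hcardS]

/-- **A transversal `R₀` of the level-zero neighbours with `#R₀ = √q − 1`**: unitriangular `u(β) ∈ U(σ, J₀)` with `v β = v(ϖ⁻¹)`, one for each
class of `(ϖ⁻¹𝒪⁰ ∖ 𝒪⁰) ∕ 𝒪⁰` (★ `exists_transversal_traceZero` pushed through the section ★ `exists_unitriangular_apply_eq_two`).
[cite: BruhatTits1972, (4.4.4)] [cite: Serre1979, Ch. V §2] [cite: Rogawski1990, §1.10 p. 14] -/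
theorem exists_transversal_unip_two [DecidableEq (unitaryGroupOfForm σ ((StdForm.antidiagonal 2).over K))]
    (hd : UnramifiedLocalConjDatum σ ϖ) (hσ : ∃ x : K, σ x ≠ x) [Finite 𝓀[K]] :
    ∃ R0 : Finset (unitaryGroupOfForm σ ((StdForm.antidiagonal 2).over K)),
      (∀ u ∈ R0, (u : GL (Fin 2) K) ∈ upperUnitriangular (Fin 2) K ∧
        Valued.v (((u : GL (Fin 2) K) : Matrix (Fin 2) (Fin 2) K) 0 1) = WithZero.exp (1 : ℤ)) ∧
      (∀ u ∈ R0, ∀ u' ∈ R0,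
        Valued.v (((u' : GL (Fin 2) K) : Matrix (Fin 2) (Fin 2) K) 0 1 - ((u : GL (Fin 2) K) : Matrix (Fin 2) (Fin 2) K) 0 1) ≤ 1 → u = u') ∧
      (∀ u : unitaryGroupOfForm σ ((StdForm.antidiagonal 2).over K), (u : GL (Fin 2) K) ∈ upperUnitriangular (Fin 2) K →
        Valued.v (((u : GL (Fin 2) K) : Matrix (Fin 2) (Fin 2) K) 0 1) = WithZero.exp (1 : ℤ) →
        ∃ r ∈ R0, Valued.v (((u : GL (Fin 2) K) : Matrix (Fin 2) (Fin 2) K) 0 1 - ((r : GL (Fin 2) K) : Matrix (Fin 2) (Fin 2) K) 0 1) ≤ 1) ∧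
      R0.card = Nat.sqrt (Nat.card 𝓀[K]) - 1 := by
  obtain ⟨R0, hR0, hR0_inj, hR0_surj, hcard0⟩ := hd.exists_transversal_traceZero hσ
  -- the unipotent section `β ↦ u(β)`
  have hex : ∀ y : (AddMonoidHom.id K + σ.toAddMonoidHom).ker, ∃ g : unitaryGroupOfForm σ ((StdForm.antidiagonal 2).over K),
      (g : GL (Fin 2) K) ∈ upperUnitriangular (Fin 2) K ∧ ((g : GL (Fin 2) K) : Matrix (Fin 2) (Fin 2) K) 0 1 = (y : K) := fun y =>
    hd.exists_unitriangular_apply_eq_two ((mem_ker_id_add_iff (σ := σ) (y : K)).1 y.2)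
  choose useq huU hu01 using hex
  have hinj : Function.Injective useq := fun y y' h => Subtype.ext (by rw [← hu01 y, ← hu01 y', h])
  refine ⟨R0.image useq, ?_, ?_, ?_, ?_⟩
  · intro u hu
    obtain ⟨y, hy, rfl⟩ := Finset.mem_image.1 hu
    exact ⟨huU y, by rw [hu01]; exact hR0 y hy⟩
  · intro u hu u' hu' hv
    obtain ⟨y, hy, rfl⟩ := Finset.mem_image.1 hu
    obtain ⟨y', hy', rfl⟩ := Finset.mem_image.1 hu'
    rw [hu01, hu01] at hv
    rw [hR0_inj y hy y' hy' hv]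
  · intro u hu hβ
    have hy : ((u : GL (Fin 2) K) : Matrix (Fin 2) (Fin 2) K) 0 1 ∈ (AddMonoidHom.id K + σ.toAddMonoidHom).ker :=
      (mem_ker_id_add_iff _).2 (apply_add_map_apply_eq_two hu)
    obtain ⟨r, hr, hrv⟩ := hR0_surj ⟨_, hy⟩ hβ
    exact ⟨useq r, Finset.mem_image_of_mem _ hr, by rw [hu01]; exact hrv⟩
  · rw [Finset.card_image_of_injective _ hinj, hcard0]

/-- **THE HECKE-NEIGHBOUR DATUM OF THE UNRAMIFIED `U(1,1)`, PACKAGED** — for `hd : UnramifiedLocalConjDatum σ ϖ` with `σ ≠ id`, finite residue field,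
and ANY `t ∈ U(σ, J₀)(K)` with `(t : GL₂) = diag(ϖ, ϖ⁻¹)`: `K_P ≤ K₀` is contracted by `t`, `t⁻¹ ∈ K₀tK₀`, the shells `K₀tᵐK₀` are pairwise disjoint,
and there are finite `X₊` (`x t⁻¹ ∈ K_P`, `|X₊| = q`) and `X₀` (`t x t⁻¹ ∈ K_P`, `|X₀| = √q − 1`) with `X₊ ∪ X₀ ∪ {t⁻¹}` a transversal of `K₀tK₀∕K₀` —
LITERALLY the binder list of ★ `K2LiuHeckeShellRecursion.heckeOperator_pow_apply_eq_smul_of_contracting` (p857139) minus the representation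
(witnesses `X₊ = R₊ t`, `X₀ = R₀`). For `K = E_w` inert over `F_v`: `q = q_v²`, `√q = q_v`, so `(|X₊|, |X₀|, #X) = (q_v², q_v − 1, q_v² + q_v)`.
[cite: BruhatTits1972, (4.4.4)] [cite: Macdonald1971, Ch. V §3] [cite: SerreTrees1980, II.1.1] -/
theorem exists_contractingTransversal_unitary_two [DecidableEq (unitaryGroupOfForm σ ((StdForm.antidiagonal 2).over K))]
    (hd : UnramifiedLocalConjDatum σ ϖ) (hσ : ∃ x : K, σ x ≠ x) [Finite 𝓀[K]]
    (t : unitaryGroupOfForm σ ((StdForm.antidiagonal 2).over K))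
    (ht : (t : GL (Fin 2) K) = zpowDiagGL (uniformizer_ne_zero hd.vϖ) ![(1 : ℤ), -1]) :
    ∃ Xp X0 : Finset (unitaryGroupOfForm σ ((StdForm.antidiagonal 2).over K)),
      hd.borelLatticeU ⊓ unitaryInt σ ((StdForm.antidiagonal 2).over K) ≤ unitaryInt σ ((StdForm.antidiagonal 2).over K) ∧
      (∀ u ∈ hd.borelLatticeU ⊓ unitaryInt σ ((StdForm.antidiagonal 2).over K), t * u * t⁻¹ ∈ hd.borelLatticeU ⊓ unitaryInt σ ((StdForm.antidiagonal 2).over K)) ∧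
      t⁻¹ ∈ DoubleCoset.doubleCoset t (unitaryInt σ ((StdForm.antidiagonal 2).over K) : Set _) (unitaryInt σ ((StdForm.antidiagonal 2).over K)) ∧
      (∀ m n : ℕ, m ≠ n → Disjoint
        (DoubleCoset.doubleCoset (t ^ m) (unitaryInt σ ((StdForm.antidiagonal 2).over K) : Set _) (unitaryInt σ ((StdForm.antidiagonal 2).over K)))
        (DoubleCoset.doubleCoset (t ^ n) (unitaryInt σ ((StdForm.antidiagonal 2).over K) : Set _) (unitaryInt σ ((StdForm.antidiagonal 2).over K)))) ∧
      (∀ x ∈ Xp, x * t⁻¹ ∈ hd.borelLatticeU ⊓ unitaryInt σ ((StdForm.antidiagonal 2).over K)) ∧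
      (∀ x ∈ X0, t * x * t⁻¹ ∈ hd.borelLatticeU ⊓ unitaryInt σ ((StdForm.antidiagonal 2).over K)) ∧
      Set.BijOn (fun x : unitaryGroupOfForm σ ((StdForm.antidiagonal 2).over K) =>
          (x : unitaryGroupOfForm σ ((StdForm.antidiagonal 2).over K) ⧸ unitaryInt σ ((StdForm.antidiagonal 2).over K)))
        (Xp ∪ X0 ∪ {t⁻¹} : Finset _)
        (orbit (unitaryInt σ ((StdForm.antidiagonal 2).over K))
          (t : unitaryGroupOfForm σ ((StdForm.antidiagonal 2).over K) ⧸ unitaryInt σ ((StdForm.antidiagonal 2).over K))) ∧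
      Xp.card = Nat.card 𝓀[K] ∧ X0.card = Nat.sqrt (Nat.card 𝓀[K]) - 1 := by
  obtain ⟨Rp, hRp, hRp_inj, hRp_surj, hcardp⟩ := exists_transversal_borelInt_two hd hσ ht
  obtain ⟨R0, hR0, hR0_inj, hR0_surj, hcard0⟩ := exists_transversal_unip_two hd hσ
  have hX := bijOn_heckeNeighbours_two hd ht hRp hRp_inj hRp_surj hR0 hR0_inj hR0_surj
  refine ⟨Rp.image (· * t), R0, inf_le_right, fun u hu => conj_mem_borelInt_two hd ht hu, inv_mem_doubleCoset_two hd t,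
    fun m n hmn => disjoint_doubleCoset_pow_two hd ht hmn, fun x hx => ?_, fun x hx => ?_, hX, ?_, hcard0⟩
  · obtain ⟨u, hu, rfl⟩ := Finset.mem_image.1 hx
    rw [mul_inv_cancel_right]; exact hRp u hu
  · exact conj_unip_mem_borelInt_two hd ht (hR0 x hx).1 (by
      rw [(hR0 x hx).2, WithZero.exp_le_exp]; norm_num)
  · rw [Finset.card_image_of_injective _ (mul_left_injective t), hcardp]

end Summit.HodgeConjecture.HodgeConjecture.Cruxes.HLiu418.K2LiuRankOneHeckeNeighboursTwo

end
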